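import Mathlib
import Literature.NumberTheory.LFunctions.ZetaOneLineBounds
import Literature.NumberTheory.LFunctions.ZetaClassicalRegionBounds
import HarnessLib

/-!
# `ζ(s)` near `σ = 1` at depth `A/log|t|` for arbitrary `A` (Titchmarsh, Theorem 3.5), and `ζ₁` near the pole

Topic `Literature/NumberTheory/LFunctions/Zhang2022` (Landau–Siegel audit tree; verdict-neutral).
These are the size inputs for the "standard estimates" of Y. Zhang, arXiv:2211.02515v1 (2022)
[Zhang2022LandauSiegel], §7 p. 40 (the shifted contour of (7.19), node `Z22:§7.u049`: vertical
segment `σ = 1 − 𝓛⁻¹`, `|t| ≤ D`), where `ζ(s+β_j)` and `1/ζ(s)` must be bounded at depth `𝓛⁻¹`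
below `σ = 1` up to height `D = e^𝓛` — i.e. at depth `A/log|t|` with `A ≥ 1`, beyond the range
`A = 1/2` of the tree's `ZetaOneLine.norm_riemannZeta_le_log`. Everything here is PROVED (theorems
only, no new definitions):

* `norm_riemannZeta_le_exp_mul_log` — **Titchmarsh's Theorem 3.5 with a general constant**: for
  `|t| ≥ 3`, `σ ≥ 1/2`, `σ ≥ 1 − A/log|t|` (`A ≥ 0`): `‖ζ(σ+it)‖ ≤ 8e^A log|t|` (same proof as the
  tree's `A = 1/2` version: approximate formula (3.5.3) with `N = ⌊|t|⌋`, `|n^{−s}| ≤ e^A/n`);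
* `exists_bound_riemannZeta₁_rect` — Mathlib's entire `ζ₁ = (s−1)ζ(s)` is bounded on `[0,2]×[−5,5]`;
  `exists_bound_riemannZeta_rect` — `‖ζ(s)‖ ≤ M₀ + 1/‖s−1‖` on `[1/2,2]×[−3,3]`;
* `norm_riemannZeta_le_of_re`, `norm_inv_riemannZeta_le_of_re` — `‖ζ(s)‖, ‖ζ(s)⁻¹‖ ≤ 1 + 1/δ` for
  `Re s ≥ 1 + δ` (the tree's `ZetaClassicalRegion` bounds, repackaged).

WHAT THIS IS NOT: any statement about the manuscript's Theorems 1–2 or Landau–Siegel zeros.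

## References

* E. C. Titchmarsh, *The Theory of the Riemann Zeta-Function*, 2nd ed. (1986), §2.1 (2.1.4),
  (2.1.16); §3.5 Theorem 3.5 (3.5.1)–(3.5.3); §3.11 (3.11.8). [cite: Titchmarsh1986, Thm. 3.5]
* Y. Zhang, arXiv:2211.02515v1 (2022), §7 p. 40, tex L2108–L2121 (use-site).
  [cite: Zhang2022LandauSiegel, §7 p.40]
-/

noncomputable section

open Complex Set MeasureTheory

namespace Literature.NumberTheory.LFunctions.Zhang2022.ZetaNearOne

/-! ### §1. Titchmarsh's Theorem 3.5 with a general constant `A` -/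

/-- In the region `σ ≥ 1 − A/log|t|`, `|t| ≥ 3`: for `1 ≤ y ≤ |t|`, `y^{1−σ} ≤ e^A`.
[cite: Titchmarsh1986, §3.5 proof of Thm. 3.5] -/
theorem rpow_one_sub_le_exp {y t σ A : ℝ} (hA : 0 ≤ A) (hy : 1 ≤ y) (hyt : y ≤ |t|) (ht : 3 ≤ |t|)
    (hσ : 1 - A / Real.log |t| ≤ σ) : y ^ (1 - σ) ≤ Real.exp A := by
  have hL : 1 < Real.log |t| :=
    MertensBound.one_lt_log_three.trans_le (Real.log_le_log (by norm_num) ht)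
  have hL0 : 0 < Real.log |t| := zero_lt_one.trans hL
  have hy0 : 0 < y := zero_lt_one.trans_le hy
  have hlogy : 0 ≤ Real.log y := Real.log_nonneg hy
  have hlogy' : Real.log y ≤ Real.log |t| := Real.log_le_log hy0 hyt
  rw [Real.rpow_def_of_pos hy0]
  refine Real.exp_le_exp.mpr ?_
  by_cases h1 : 1 - σ ≤ 0
  · nlinarith
  · push Not at h1
    have h2 : 1 - σ ≤ A / Real.log |t| := by linarith
    calc Real.log y * (1 - σ) ≤ Real.log |t| * (A / Real.log |t|) := by gcongr
      _ = A := by field_simp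

/-- **Titchmarsh's Theorem 3.5 with a general constant**: for `|t| ≥ 3`, `σ ≥ 1/2` and
`σ ≥ 1 − A/log|t|` (`A ≥ 0`), `‖ζ(σ + it)‖ ≤ 8e^A log|t|`. The proof is Titchmarsh's (the tree's
`ZetaOneLine.norm_riemannZeta_le_log` is the case `A = 1/2`): the approximate formula (3.5.3)
with `N = ⌊|t|⌋`, `|n^{−s}| ≤ e^A/n` for `n ≤ N`, trivial bounds for the remaining terms.
[cite: Titchmarsh1986, Thm. 3.5 (3.5.1)–(3.5.3)] -/
theorem norm_riemannZeta_le_exp_mul_log {s : ℂ} {A : ℝ} (hA : 0 ≤ A) (ht : 3 ≤ |s.im|)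
    (hhalf : 1 / 2 ≤ s.re) (hσ : 1 - A / Real.log |s.im| ≤ s.re) :
    ‖riemannZeta s‖ ≤ 8 * Real.exp A * Real.log |s.im| := by
  set t := s.im with htdef
  set σ := s.re with hσdef
  have hL : 1 < Real.log |t| :=
    MertensBound.one_lt_log_three.trans_le (Real.log_le_log (by norm_num) ht)
  have hL0 : 0 < Real.log |t| := zero_lt_one.trans hL
  have hE : 1 ≤ Real.exp A := Real.one_le_exp hA
  have hσ0 : 0 < σ := by linarith
  have hs1 : s ≠ 1 := by
    intro h
    have : t = 0 := by rw [htdef, h]; simp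
    rw [this, abs_zero] at ht
    linarith
  set N : ℕ := ⌊|t|⌋₊ with hNdef
  have hN3 : 3 ≤ N := Nat.le_floor (by simpa using ht)
  have hN1 : 1 ≤ N := le_trans (by norm_num) hN3
  have hNt : (N : ℝ) ≤ |t| := Nat.floor_le (abs_nonneg t)
  have hNt' : |t| / 2 ≤ N := by
    have := Nat.lt_floor_add_one |t|
    rw [← hNdef] at this
    linarith
  have hN0 : (0 : ℝ) < N := by exact_mod_cast (lt_of_lt_of_le (by norm_num) hN3)
  have hformula := ZetaOneLine.riemannZeta_eq_sum_add_sub_integral (by simpa using hσ0) hs1 hN1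
  -- (a) the partial sum
  have ha : ‖∑ n ∈ Finset.Icc 1 N, (n : ℂ) ^ (-s)‖ ≤ 2 * Real.exp A * Real.log |t| := by
    have h1 : ‖∑ n ∈ Finset.Icc 1 N, (n : ℂ) ^ (-s)‖ ≤
        ∑ n ∈ Finset.Icc 1 N, Real.exp A * (n : ℝ)⁻¹ := by
      refine (norm_sum_le _ _).trans (Finset.sum_le_sum fun n hn ↦ ?_)
      rw [Finset.mem_Icc] at hn
      have hn0 : 0 < n := hn.1
      have hnR : (1 : ℝ) ≤ n := by exact_mod_cast hn.1
      have hnt : (n : ℝ) ≤ |t| := le_trans (by exact_mod_cast hn.2) hNt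
      rw [norm_natCast_cpow_of_pos hn0, neg_re, ← hσdef]
      have : (n : ℝ) ^ (-σ) = (n : ℝ) ^ (1 - σ) * (n : ℝ)⁻¹ := by
        rw [← Real.rpow_neg_one, ← Real.rpow_add (by positivity)]
        ring_nf
      rw [this]
      gcongr
      exact rpow_one_sub_le_exp hA hnR hnt ht hσ
    have h2 : ∑ n ∈ Finset.Icc 1 N, (n : ℝ)⁻¹ ≤ 1 + Real.log N := by
      have := harmonic_le_one_add_log N
      simpa [harmonic_eq_sum_Icc] using this
    have h3 : Real.log N ≤ Real.log |t| := Real.log_le_log hN0 hNt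
    calc ‖∑ n ∈ Finset.Icc 1 N, (n : ℂ) ^ (-s)‖ ≤ ∑ n ∈ Finset.Icc 1 N, Real.exp A * (n : ℝ)⁻¹ := h1
      _ = Real.exp A * ∑ n ∈ Finset.Icc 1 N, (n : ℝ)⁻¹ := by rw [Finset.mul_sum]
      _ ≤ Real.exp A * (1 + Real.log N) := by gcongr
      _ ≤ Real.exp A * (2 * Real.log |t|) := by gcongr; linarith
      _ = 2 * Real.exp A * Real.log |t| := by ring
  -- (b) the term `N^{1-s}/(s-1)`
  have hb : ‖(N : ℂ) ^ (1 - s) / (s - 1)‖ ≤ Real.exp A := by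
    rw [norm_div, norm_natCast_cpow_of_pos (by omega), sub_re, one_re, ← hσdef]
    have hs1norm : |t| ≤ ‖s - 1‖ := by
      have := abs_im_le_norm (s - 1)
      simpa [← htdef] using this
    have h3 : (N : ℝ) ^ (1 - σ) ≤ Real.exp A :=
      rpow_one_sub_le_exp hA (by exact_mod_cast hN1) hNt ht hσ
    have hpos : 0 < ‖s - 1‖ := lt_of_lt_of_le (by linarith) hs1norm
    rw [div_le_iff₀ hpos]
    calc (N : ℝ) ^ (1 - σ) ≤ Real.exp A := h3
      _ = Real.exp A * 1 := (mul_one _).symm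
      _ ≤ Real.exp A * ‖s - 1‖ := by gcongr; linarith
  -- (c) the tail integral
  have hc : ‖s * ∫ x in Ioi (N : ℝ), ((Int.fract x : ℝ) : ℂ) * (x : ℂ) ^ (-(s + 1))‖ ≤
      5 * Real.exp A := by
    rw [norm_mul]
    have h1 := ZetaOneLine.norm_integral_Ioi_fract_mul_cpow_le (s := s) (by simpa using hσ0)
      (show (1 : ℝ) ≤ N by exact_mod_cast hN1)
    rw [← hσdef] at h1
    have hsn : ‖s‖ ≤ σ + |t| := by
      have := Complex.norm_le_abs_re_add_abs_im s
      rwa [← hσdef, ← htdef, abs_of_pos hσ0] at this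
    have hNσ : (N : ℝ) ^ (-σ) ≤ 2 * Real.exp A / |t| := by
      have : (N : ℝ) ^ (-σ) = (N : ℝ) ^ (1 - σ) * (N : ℝ)⁻¹ := by
        rw [← Real.rpow_neg_one, ← Real.rpow_add hN0]
        ring_nf
      rw [this]
      have h3 : (N : ℝ) ^ (1 - σ) ≤ Real.exp A :=
        rpow_one_sub_le_exp hA (by exact_mod_cast hN1) hNt ht hσ
      have h4 : (N : ℝ)⁻¹ ≤ 2 / |t| := by
        rw [inv_eq_one_div, div_le_div_iff₀ hN0 (by linarith)]
        linarith
      calc (N : ℝ) ^ (1 - σ) * (N : ℝ)⁻¹ ≤ Real.exp A * (2 / |t|) :=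
            mul_le_mul h3 h4 (by positivity) (by positivity)
        _ = 2 * Real.exp A / |t| := by ring
    have ht0 : 0 < |t| := by linarith
    calc ‖s‖ * ‖∫ x in Ioi (N : ℝ), ((Int.fract x : ℝ) : ℂ) * (x : ℂ) ^ (-(s + 1))‖
        ≤ (σ + |t|) * ((N : ℝ) ^ (-σ) / σ) := by gcongr
      _ ≤ (σ + |t|) * ((2 * Real.exp A / |t|) / σ) := by gcongr
      _ = 2 * Real.exp A * (1 / |t| + 1 / σ) := by field_simp
      _ ≤ 2 * Real.exp A * (1 / 3 + 1 / (1 / 2)) := by gcongr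
      _ ≤ 5 * Real.exp A := by nlinarith
  rw [hformula]
  calc ‖∑ n ∈ Finset.Icc 1 N, (n : ℂ) ^ (-s) + (N : ℂ) ^ (1 - s) / (s - 1) -
        s * ∫ x in Ioi (N : ℝ), ((Int.fract x : ℝ) : ℂ) * (x : ℂ) ^ (-(s + 1))‖
      ≤ ‖∑ n ∈ Finset.Icc 1 N, (n : ℂ) ^ (-s)‖ + ‖(N : ℂ) ^ (1 - s) / (s - 1)‖ +
        ‖s * ∫ x in Ioi (N : ℝ), ((Int.fract x : ℝ) : ℂ) * (x : ℂ) ^ (-(s + 1))‖ :=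
        (norm_sub_le _ _).trans (by gcongr; exact norm_add_le _ _)
    _ ≤ 2 * Real.exp A * Real.log |t| + Real.exp A + 5 * Real.exp A := by gcongr
    _ ≤ 8 * Real.exp A * Real.log |t| := by nlinarith

/-! ### §2. Near the pole: `ζ₁ = (s − 1)ζ(s)` and `ζ(s) − 1/(s−1)` on a compact rectangle -/

/-- `ζ₁` (Mathlib's entire `riemannZeta₁`, `= (s−1)ζ(s)` off `s = 1`) is bounded on the rectangle
`0 ≤ σ ≤ 2`, `|t| ≤ 5` (compactness). [cite: Titchmarsh1986, §2.1 eq. (2.1.16)] -/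
theorem exists_bound_riemannZeta₁_rect :
    ∃ M : ℝ, 1 ≤ M ∧ ∀ s : ℂ, 0 ≤ s.re → s.re ≤ 2 → |s.im| ≤ 5 → ‖riemannZeta₁ s‖ ≤ M := by
  obtain ⟨M, hM⟩ := (IsCompact.reProdIm isCompact_Icc isCompact_Icc :
      IsCompact (Set.Icc (0 : ℝ) 2 ×ℂ Set.Icc (-5 : ℝ) 5)).exists_bound_of_continuousOn
    differentiable_riemannZeta₁.continuous.continuousOn
  refine ⟨max M 1, le_max_right _ _, fun s h1 h2 h3 => ?_⟩
  exact (hM s ⟨⟨h1, h2⟩, abs_le.1 h3⟩).trans (le_max_left _ _)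

/-- Near the pole, `‖ζ(s)‖ ≤ M₀ + 1/‖s − 1‖` on `1/2 ≤ σ ≤ 2`, `|t| ≤ 3`, `s ≠ 1`, with the tree's
bound `M₀` for `ζ(s) − 1/(s−1)` there. [cite: Titchmarsh1986, §2.1 eq. (2.1.16)] -/
theorem exists_bound_riemannZeta_rect :
    ∃ M : ℝ, 0 ≤ M ∧ ∀ s : ℂ, 1 / 2 ≤ s.re → s.re ≤ 2 → |s.im| ≤ 3 → s ≠ 1 →
      ‖riemannZeta s‖ ≤ M + 1 / ‖s - 1‖ := by
  obtain ⟨M, hM0, hM⟩ := ZetaClassicalRegion.exists_bound_sub_inv_rect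
  refine ⟨M, hM0, fun s h1 h2 h3 hs => ?_⟩
  have h := hM s h1 h2 h3 hs
  calc ‖riemannZeta s‖ = ‖(riemannZeta s - 1 / (s - 1)) + 1 / (s - 1)‖ := by rw [sub_add_cancel]
    _ ≤ ‖riemannZeta s - 1 / (s - 1)‖ + ‖1 / (s - 1)‖ := norm_add_le _ _
    _ ≤ M + 1 / ‖s - 1‖ := by rw [norm_div, norm_one]; gcongr

/-! ### §3. Right of `σ = 1`: `ζ` and `1/ζ` -/

/-- For `Re s = 1 + δ` with `δ > 0`: `‖ζ(s)‖ ≤ 1 + 1/δ`. [cite: Titchmarsh1986, §2.1 eq. (2.1.4)] -/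
theorem norm_riemannZeta_le_of_re {s : ℂ} {δ : ℝ} (hδ : 0 < δ) (hs : 1 + δ ≤ s.re) :
    ‖riemannZeta s‖ ≤ 1 + 1 / δ := by
  have hs1 : 1 < s.re := by linarith
  have hne : s.re - 1 ≠ 0 := ne_of_gt (by linarith)
  calc ‖riemannZeta s‖ ≤ s.re / (s.re - 1) := ZetaClassicalRegion.norm_riemannZeta_le_of_one_lt_re hs1
    _ = 1 + 1 / (s.re - 1) := by field_simp; ring
    _ ≤ 1 + 1 / δ := by gcongr; linarith

/-- For `Re s ≥ 1 + δ` with `δ > 0`: `‖ζ(s)⁻¹‖ ≤ 1 + 1/δ`. [cite: Titchmarsh1986, Thm. 3.11 eq. (3.11.8)] -/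
theorem norm_inv_riemannZeta_le_of_re {s : ℂ} {δ : ℝ} (hδ : 0 < δ) (hs : 1 + δ ≤ s.re) :
    ‖(riemannZeta s)⁻¹‖ ≤ 1 + 1 / δ := by
  have h1 : 1 + 1 / (1 / δ) ≤ s.re := by rwa [one_div_one_div]
  exact ZetaClassicalRegion.norm_inv_le_of_re_ge (one_div_pos.mpr hδ) h1

end Literature.NumberTheory.LFunctions.Zhang2022.ZetaNearOne
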